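import Mathlib
import HarnessLib
import Summits.HubbardSuperconductivity.HubbardSuperconductivity.Theorems.ChiralWindowDefsSector

/-!
# Certificate vocabulary, `E_x`-BLOCK form of the doublet channel (crux `CwKLChiralWindow`, route `ChiralWindow`, line `Sketch`)

Third companion of `Theorems/ChiralWindowDefs.lean` (records), `…DefsResidual.lean` (residual-form checker `checkR`) and
`…DefsSector.lean` (sector row bounds, enclosures `KLCert.EnclosuresRS`); crux item stmt-HubbardSuperconductivity-1741.

For the two-dimensional irrep `E` the residual-form checker works on the whole `E` sector: Temple's square-mass level is produced
with the doublet multiplicity `d = 2` (`Hhi - 2 rhohi² ≤ beta²`) and the node test needs the exact-doublet condition `Hhi < 3 rhohi²`.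
Both count the bottom doublet AND the second doublet twice, which makes `E` the tight spot of the certificate (float census at `μ*`:
after deflating the four positive doublets `Hhi ≈ 8.9e-4` against `3ρ² = 1.08e-3` — the square mass of `E` must be certified to ≈ 2 %).
The `E_x`-block form halves the problem: the `E` sector splits under the reflection `S : (k₀,k₁) ↦ (k₀,-k₁)` into the `S`-even part
(`E_x` functions, where the cosine trials live) and the `S`-odd part, swapped isometrically by the quarter turn; on the `E_x` block the
bottom is SIMPLE (`d = 1`) and the square mass is `Hhi/2` provided the deflation is quarter-turn symmetric (its vectors come in pairs
`u, u ∘ rot`).  Conditions become `Hhi/2 - rhohi² ≤ beta²` (level) and `Hhi < 4 rhohi²` (simplicity), i.e. `Hhi` to ≈ 40 %.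

This file only NAMES the `E_x`-form objects over the SAME records and the SAME enclosures `KLCert.EnclosuresRS`:
`KLTrig.rot1` (the quarter-turn of a trigonometric polynomial, exact over `ℚ`), `KLTrig.beqB`, `KLTrig.cosOnly`,
`KLBlock.deflPairsOK` (deflation list = consecutive pairs `(c,i),(c,i')` with `tab[i'] = rot1 tab[i]`), `KLBlock.templeOKX`
(`E`: the `E_x` conditions; other channels: `templeOKR`), `lowerOKX`, `lowerX`, `KLBox.basicOKX/isolationOKX/b1gLeadsOKX/eLeadsOKX/
nodeOKX`, `KLCert.checkX`.  Soundness (`checkX = true → EnclosuresRS → clauses N0–N5`) is proved in the companion Theorems files.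
-/

noncomputable section

namespace Summit.HubbardSuperconductivity.HubbardSuperconductivity.Theorems.CwKLChiralWindow

set_option linter.dupNamespace false -- summit = problem name (single-conjunct summit), D-0017

open MeasureTheory Literature.MathematicalPhysics.QuantumLattice

namespace KLTrig

/-- `cos (j π/2)` for natural `j`: `1, 0, -1, 0` by `j mod 4`. [folklore] -/
def cosQuarter (j : ℕ) : ℚ := if j % 4 = 0 then 1 else if j % 4 = 2 then -1 else 0

/-- `sin (j π/2)` for natural `j`: `0, 1, 0, -1` by `j mod 4`. [folklore] -/
def sinQuarter (j : ℕ) : ℚ := if j % 4 = 1 then 1 else if j % 4 = 3 then -1 else 0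

/-- **The quarter turn of a trigonometric polynomial**: the polynomial `θ ↦ t(θ + π/2)` written again as cosine and sine lists
(`cos(j(θ+π/2)) = cos(jπ/2) cos jθ - sin(jπ/2) sin jθ`, `sin(j(θ+π/2)) = cos(jπ/2) sin jθ + sin(jπ/2) cos jθ`), so that
`(rot1 t).toFun = t.toFun ∘ rotMomentum` (`arg (rot k) ≡ arg k + π/2`). [folklore] -/
def rot1 (t : KLTrig) : KLTrig :=
  ⟨(t.cosC.map fun p => (p.1, p.2 * cosQuarter p.1)) ++ (t.sinC.map fun p => (p.1, p.2 * sinQuarter p.1)),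
   (t.cosC.map fun p => (p.1, -(p.2 * sinQuarter p.1))) ++ (t.sinC.map fun p => (p.1, p.2 * cosQuarter p.1))⟩

/-- Syntactic equality of two trigonometric polynomials (equal coefficient lists). [folklore] -/
def beqB (t t' : KLTrig) : Bool := decide (t.cosC = t'.cosC) && decide (t.sinC = t'.sinC)

/-- A cosine-only polynomial (even under `θ ↦ -θ`, i.e. under the reflection `S`). [folklore] -/
def cosOnly (t : KLTrig) : Bool := t.sinC.isEmpty

end KLTrig

namespace KLBlock

/-- The deflation list consists of consecutive quarter-turn pairs `(c, i), (c, i')` with `tab[i'] = rot1 tab[i]` (so the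
deflation kernel `Σ c u⊗u` is invariant under the quarter turn). [folklore] -/
def deflPairsList (tab : List KLTrig) : List (ℚ × ℕ) → Bool
  | [] => true
  | [_] => false
  | d :: d' :: rest => decide (d.1 = d'.1) && (klTab tab d'.2).beqB (klTab tab d.2).rot1 && deflPairsList tab rest

/-- The block's deflation is quarter-turn paired. [folklore] -/
def deflPairsOK (b : KLBlock) (tab : List KLTrig) : Bool := deflPairsList tab b.defl

/-- The `E_x`-form Temple data are usable: for `χ = E`, Ritz data with a COSINE-ONLY trial, admissible quarter-turn-paired
deflation, `0 ≤ Thi` (`= Ehi`), `beta ≤ 0`, `Hhi/2 - rhohi² ≤ beta²`, `rhohi < beta`; for the other channels, `templeOKR`.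
[cite: ReedSimonIV1978, Thm. XIII.5] -/
def templeOKX (b : KLBlock) (tab : List KLTrig) (χ : D4Irrep) : Bool :=
  if χ = D4Irrep.E then
    b.ritzOK tab χ && b.deflOK tab χ && b.deflPairsOK tab && (klTab tab b.trial).cosOnly && decide (0 ≤ b.Thi) &&
      decide (b.beta ≤ 0) && decide (b.Hhi / 2 - b.rhohi ^ 2 ≤ b.beta ^ 2) && decide (b.rhohi < b.beta)
  else b.templeOKR tab χ

/-- A certified lower bound is available (`E_x` form): Temple data on a trial block, far-channel data on a block without trial.
[folklore] -/
def lowerOKX (b : KLBlock) (tab : List KLTrig) (χ : D4Irrep) : Bool :=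
  (b.useTrial && b.templeOKX tab χ) || (!b.useTrial && b.farOK tab χ)

/-- The certified lower bound, `E_x` form: `min (templeR ρlo) (templeR ρhi)` on a trial block, `-s` on a far block. [folklore] -/
def lowerX (b : KLBlock) (tab : List KLTrig) (χ : D4Irrep) : ℚ :=
  if b.useTrial && b.templeOKX tab χ then min (b.templeR b.rholo) (b.templeR b.rhohi) else -b.s

end KLBlock

namespace KLBox

/-- The box is well formed and every channel has a certified lower bound (`E_x` form). [folklore] -/
def basicOKX (bx : KLBox) (tab : List KLTrig) : Bool :=
  decide (-4 < bx.mulo) && decide (bx.mulo ≤ bx.muhi) && decide (bx.muhi < 0) &&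
    bx.bB1g.ritzOK tab .B1g && bx.bE.ritzOK tab .E && !bx.bB1g.withU && !bx.bE.withU &&
    bx.bA1g.lowerOKX tab .A1g && bx.bA2g.lowerOKX tab .A2g && bx.bB1g.lowerOKX tab .B1g &&
    bx.bB2g.lowerOKX tab .B2g && bx.bE.lowerOKX tab .E

/-- Two-channel isolation and negativity on the box (N3, N4), `E_x` form. [folklore] -/
def isolationOKX (bx : KLBox) (tab : List KLTrig) (γ : ℚ) : Bool :=
  decide (bx.bB1g.upper < 0) && decide (bx.bE.upper < 0) &&
    decide (min bx.bB1g.upper bx.bE.upper + γ ≤ bx.bA1g.lowerX tab .A1g) &&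
    decide (min bx.bB1g.upper bx.bE.upper + γ ≤ bx.bA2g.lowerX tab .A2g) &&
    decide (min bx.bB1g.upper bx.bE.upper + γ ≤ bx.bB2g.lowerX tab .B2g)

/-- `B1g` leads every other channel by `γ` (N1), `E_x` form. [folklore] -/
def b1gLeadsOKX (bx : KLBox) (tab : List KLTrig) (γ : ℚ) : Bool :=
  decide (bx.bB1g.upper + γ ≤ bx.bA1g.lowerX tab .A1g) && decide (bx.bB1g.upper + γ ≤ bx.bA2g.lowerX tab .A2g) &&
    decide (bx.bB1g.upper + γ ≤ bx.bB2g.lowerX tab .B2g) && decide (bx.bB1g.upper + γ ≤ bx.bE.lowerX tab .E)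

/-- `E` leads every other channel by `γ` (N2), `E_x` form. [folklore] -/
def eLeadsOKX (bx : KLBox) (tab : List KLTrig) (γ : ℚ) : Bool :=
  decide (bx.bE.upper + γ ≤ bx.bA1g.lowerX tab .A1g) && decide (bx.bE.upper + γ ≤ bx.bA2g.lowerX tab .A2g) &&
    decide (bx.bE.upper + γ ≤ bx.bB2g.lowerX tab .B2g) && decide (bx.bE.upper + γ ≤ bx.bB1g.lowerX tab .B1g)

/-- Node covering on the box (N5) with the constant `cov`, `E_x` form: Temple data on the `B1g` and `E` trial blocks, simplicity
of the `B1g` bottom (`Hhi < 2ρhi²`) and of the `E_x` bottom (`Hhi < 4ρhi²`), the square-root witnesses and `cov·L² ≤ (r2 - r1)²`.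
[folklore] -/
def nodeOKX (bx : KLBox) (tab : List KLTrig) (cov : ℚ) : Bool :=
  bx.bB1g.useTrial && bx.bE.useTrial && bx.bB1g.templeOKX tab .B1g && bx.bE.templeOKX tab .E &&
    decide (bx.bB1g.Hhi < 2 * bx.bB1g.rhohi ^ 2) && decide (bx.bE.Hhi < 4 * bx.bE.rhohi ^ 2) &&
    decide (0 ≤ bx.R2) && decide (0 < bx.pB) && decide (0 < bx.pE) &&
    decide (0 ≤ bx.bB1g.katoR) && decide (0 ≤ bx.bE.katoR) &&
    decide (0 ≤ bx.r1B) && decide (bx.R2 * bx.bB1g.katoR ≤ bx.r1B ^ 2) &&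
    decide (0 ≤ bx.r2B) && decide (bx.r2B ^ 2 * bx.bB1g.Nhi ≤ bx.pB) && decide (bx.r1B < bx.r2B) &&
    decide (0 ≤ bx.r1E) && decide (bx.R2 * bx.bE.katoR ≤ bx.r1E ^ 2) &&
    decide (0 ≤ bx.r2E) && decide (bx.r2E ^ 2 * bx.bE.Nhi ≤ bx.pE) && decide (bx.r1E < bx.r2E) &&
    decide (cov * (bx.bB1g.lowerX tab .B1g) ^ 2 ≤ (bx.r2B - bx.r1B) ^ 2) &&
    decide (cov * (bx.bE.lowerX tab .E) ^ 2 ≤ (bx.r2E - bx.r1E) ^ 2)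

end KLBox

namespace KLCert

/-- **The checker, `E_x` form** (same records, same enclosures `EnclosuresRS`). [folklore] -/
def checkX (c : KLCert) : Bool :=
  decide (-4 < c.mub) && decide (c.mub < c.mua) && decide (c.mua < 0) && decide (0 < c.gamma) &&
    decide (0 < c.cov) &&
    (match c.boxes.head?, c.boxes.getLast? with
      | some b₀, some b₁ => decide (b₀.mulo ≤ c.mub) && decide (c.mua ≤ b₁.muhi)
      | _, _ => false) &&
    chainOK c.boxes &&
    (c.boxes.all fun bx => bx.basicOKX c.trials && bx.isolationOKX c.trials c.gamma && bx.nodeOKX c.trials c.cov) &&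
    (c.boxes.any fun bx =>
      decide (bx.mulo ≤ c.mua) && decide (c.mua ≤ bx.muhi) && bx.b1gLeadsOKX c.trials c.gamma) &&
    (c.boxes.any fun bx =>
      decide (bx.mulo ≤ c.mub) && decide (c.mub ≤ bx.muhi) && bx.eLeadsOKX c.trials c.gamma)

end KLCert

/-- Off the doublet channel the `E_x`-form Temple test is the residual-form one. [folklore] -/
theorem klX_templeOKX_of_ne : ∀ (b : KLBlock) (tab : List KLTrig) (χ : D4Irrep), χ ≠ D4Irrep.E →
    b.templeOKX tab χ = b.templeOKR tab χ := by
  intro b tab χ h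
  simp [KLBlock.templeOKX, h]

end Summit.HubbardSuperconductivity.HubbardSuperconductivity.Theorems.CwKLChiralWindow

end
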